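import Summits.QuantumFields.YangMills.Theorems.LuscherReductionTwistedTraceScalingBTKineticSquares
import Summits.QuantumFields.YangMills.Theorems.LuscherReductionTwistedTraceScalingBTFibreProfile
import HarnessLib

/-!
# (L1) FAR PAIRS: the summed defect identity per direction and the colour-pinned lower bound `‖S‖·‖q(u_k) − q(u'_k)‖ ≤ Σ_e ‖Δ_e‖ + (balance- and pinning-small junk)`
# (lane A of S-BASE, crux `TwistedTraceScaling` stmt-QuantumFields-20203, C4-CORE, the (B-T) pen; design note `pub/ym-fleet/ym-luscher-20007-p1/COARSE-DESIGN.md` §25.9 (T-far))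

With `Δ_e = q(U_e)q(g_y) − q(g_x)q(V_e)` (`…BTKineticSquares.kinDefect = Σ_e ‖Δ_e‖²`), `S = Σ_x q(g_x)` the colour sum, and slow data `u, u'`:
* ★ `sum_edgeDefect_dir_eq` — EXACT: `Σ_x Δ_{(x,k)} = (q(u_k)S − Sq(u'_k)) + Σ_x[(q(U_{x,k}) − q(u_k))q(g_{x+k}) − q(g_x)(q(V_{x,k}) − q(u'_k))]` (torus shift invariance of `S`);
* ★★ `norm_colourSum_mul_slow_sub_le` — `‖S‖·‖q(u_k) − q(u'_k)‖ ≤ Σ_x‖Δ_{(x,k)}‖ + 2‖q(u_k) − 1‖·‖S − ‖S‖·1‖ + ‖Σ_xμ‖ + ‖Σ_xμ'‖ + A·Σ_x(‖μ‖ + ‖μ'‖)`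
  (`μ_e = q(U_e) − q(u_k)`, `A ≥ ‖q(g_x) − 1‖`; the commutator `[q(u_k), S] = [q(u_k) − 1, S − ‖S‖·1]` is what PINNING makes small);
* tube bookkeeping: `su2Quat_orthoTube_sub` (`μ_e = (chartQuat v_e − 1)q(u_k)`), `norm_chartQuat_sub_one_sq_le` (`‖chartQuat v − 1‖² ≤ 2|v|²`), ★ `norm_sum_chartQuat_sub_one_le`
  (BALANCE: `‖Σ_x (chartQuat v_{x,k} − 1)‖ ≤ Σ_x |v_{x,k}|²` — the vector parts cancel, `…ConstTubeOrtho.sum_chartQuat_eq_coe`);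
* ★★★ `far_pair_defect_bound` — on the tube, with all gauge jumps `≤ R` (`3LR < 1`) and `colourMean g ∈ fpBall ε`:
  `N(1 − 3LR)·‖q(u_k) − q(u'_k)‖ ≤ Σ_e ‖Δ_e‖ + 2εN‖q(u_k) − 1‖ + ‖v̂‖² + ‖v̂'‖² + √2·N(9LR + ε)(‖v̂‖ + ‖v̂'‖)`, `N = |Site 3 L|`,
  and `sq_sum_norm_edgeDefect_le`: `(Σ_e ‖Δ_e‖)² ≤ |E|·kinDefect`.  For a FAR pair (`‖q(u_k) − q(u'_k)‖ ≥ C_α B^{-1/2}log β` for some `k`) and the sizes of record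
  this gives `β·kinDefect ≥ 0.64·C_α² log²β`, i.e. the kernel is `e^{6B}·β^{−0.64 C_α² log β}` — super-polynomially below the floor.
HONEST FRAMING: quaternion bookkeeping for a stub of a child of the CONDITIONAL reduction route R2b1; tails/floor/assembly OPEN; C4-CORE OPEN; not infinite volume, not a gap, not Clay.
-/

set_option autoImplicit false

noncomputable section

open MeasureTheory Filter Topology Real
open scoped BigOperators Matrix Quaternion
open Literature.MathematicalPhysics.QuantumFieldTheory
open Literature.MathematicalPhysics.QuantumLattice

namespace Summit.QuantumFields.YangMills.Theorems.FemtoTransferGap.TwoLattice.ConstTube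

open Summit.QuantumFields.YangMills.Theorems.FemtoTransferGap
open Summit.QuantumFields.YangMills.Theorems.FemtoTransferGap.TwoLattice
open Summit.QuantumFields.YangMills.Theorems.FemtoTransferGap.TwoLattice.Avg

variable {L : ℕ} [NeZero L]

/-! ## §1 The summed defect identity per direction -/

/-- ★ **Summed defect, exactly**: `Σ_x Δ_{(x,k)} = (q(u_k)S − Sq(u'_k)) + Σ_x[(q(U_{x,k}) − q(u_k))q(g_{x+k}) − q(g_x)(q(V_{x,k}) − q(u'_k))]`. [folklore] -/
theorem sum_edgeDefect_dir_eq (U V : GaugeConfig 3 L SU2) (u u' : GaugeConfig 3 1 SU2) (g : Site 3 L → SU2) (k : Fin 3) :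
    ∑ x : Site 3 L, (su2Quat (U (x, k)) * su2Quat (g (x.shift k)) - su2Quat (g x) * su2Quat (V (x, k))) =
      (su2Quat (u (0, k)) * colourQuatSum L g - colourQuatSum L g * su2Quat (u' (0, k))) +
        ∑ x : Site 3 L, ((su2Quat (U (x, k)) - su2Quat (u (0, k))) * su2Quat (g (x.shift k)) - su2Quat (g x) * (su2Quat (V (x, k)) - su2Quat (u' (0, k)))) := by
  have hpt : ∀ x : Site 3 L, su2Quat (U (x, k)) * su2Quat (g (x.shift k)) - su2Quat (g x) * su2Quat (V (x, k)) =
      (su2Quat (u (0, k)) * su2Quat (g (x.shift k)) - su2Quat (g x) * su2Quat (u' (0, k))) +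
        ((su2Quat (U (x, k)) - su2Quat (u (0, k))) * su2Quat (g (x.shift k)) - su2Quat (g x) * (su2Quat (V (x, k)) - su2Quat (u' (0, k)))) := fun x => by
    noncomm_ring
  rw [Finset.sum_congr rfl fun x _ => hpt x, Finset.sum_add_distrib, Finset.sum_sub_distrib, ← Finset.mul_sum, ← Finset.sum_mul,
    sum_shift_eq L (fun x => su2Quat (g x)) k]
  rfl

/-- The commutator with the colour sum is the commutator of the DEVIATIONS: `qS − Sq = (q − 1)(S − r) − (S − r)(q − 1)` for real `r`. [folklore] -/
theorem mul_sub_mul_eq_comm_dev (q S : ℍ) (r : ℝ) : q * S - S * q = (q - 1) * (S - r • (1 : ℍ)) - (S - r • (1 : ℍ)) * (q - 1) := by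
  have hc : (r • (1 : ℍ)) * q = q * (r • (1 : ℍ)) := by rw [smul_mul_assoc, one_mul, mul_smul_comm, mul_one]
  simp only [mul_sub, sub_mul, one_mul, mul_one, hc]
  abel

/-- ★★ **Norm form**: `‖S‖·‖q(u_k) − q(u'_k)‖ ≤ Σ_x‖Δ_{(x,k)}‖ + 2‖q(u_k) − 1‖·‖S − ‖S‖·1‖ + ‖Σ_xμ‖ + ‖Σ_xμ'‖ + A·Σ_x(‖μ‖ + ‖μ'‖)`. [folklore] -/
theorem norm_colourSum_mul_slow_sub_le (U V : GaugeConfig 3 L SU2) (u u' : GaugeConfig 3 1 SU2) (g : Site 3 L → SU2) (k : Fin 3) {A : ℝ}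
    (hA : ∀ x, ‖su2Quat (g x) - 1‖ ≤ A) :
    ‖colourQuatSum L g‖ * ‖su2Quat (u (0, k)) - su2Quat (u' (0, k))‖ ≤
      ∑ x : Site 3 L, ‖su2Quat (U (x, k)) * su2Quat (g (x.shift k)) - su2Quat (g x) * su2Quat (V (x, k))‖ +
        2 * ‖su2Quat (u (0, k)) - 1‖ * ‖colourQuatSum L g - ‖colourQuatSum L g‖ • (1 : ℍ)‖ +
        ‖∑ x : Site 3 L, (su2Quat (U (x, k)) - su2Quat (u (0, k)))‖ + ‖∑ x : Site 3 L, (su2Quat (V (x, k)) - su2Quat (u' (0, k)))‖ +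
        A * ∑ x : Site 3 L, (‖su2Quat (U (x, k)) - su2Quat (u (0, k))‖ + ‖su2Quat (V (x, k)) - su2Quat (u' (0, k))‖) := by
  have hA0 : 0 ≤ A := (norm_nonneg _).trans (hA 0)
  have hid := sum_edgeDefect_dir_eq U V u u' g k
  -- abbreviations (as plain terms)
  have hsplit : ∀ x : Site 3 L, (su2Quat (U (x, k)) - su2Quat (u (0, k))) * su2Quat (g (x.shift k)) - su2Quat (g x) * (su2Quat (V (x, k)) - su2Quat (u' (0, k))) =
      ((su2Quat (U (x, k)) - su2Quat (u (0, k))) - (su2Quat (V (x, k)) - su2Quat (u' (0, k)))) +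
        ((su2Quat (U (x, k)) - su2Quat (u (0, k))) * (su2Quat (g (x.shift k)) - 1) - (su2Quat (g x) - 1) * (su2Quat (V (x, k)) - su2Quat (u' (0, k)))) := fun x => by
    noncomm_ring
  have hmain : colourQuatSum L g * (su2Quat (u (0, k)) - su2Quat (u' (0, k))) =
      ∑ x : Site 3 L, (su2Quat (U (x, k)) * su2Quat (g (x.shift k)) - su2Quat (g x) * su2Quat (V (x, k))) -
        (su2Quat (u (0, k)) * colourQuatSum L g - colourQuatSum L g * su2Quat (u (0, k))) -
        (∑ x : Site 3 L, (su2Quat (U (x, k)) - su2Quat (u (0, k))) - ∑ x : Site 3 L, (su2Quat (V (x, k)) - su2Quat (u' (0, k)))) -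
        ∑ x : Site 3 L, ((su2Quat (U (x, k)) - su2Quat (u (0, k))) * (su2Quat (g (x.shift k)) - 1) - (su2Quat (g x) - 1) * (su2Quat (V (x, k)) - su2Quat (u' (0, k)))) := by
    rw [hid, Finset.sum_congr rfl fun x _ => hsplit x, Finset.sum_add_distrib, Finset.sum_sub_distrib]
    noncomm_ring
  have hn := congrArg (fun z : ℍ => ‖z‖) hmain
  rw [norm_mul] at hn
  -- commutator
  have hcomm : ‖su2Quat (u (0, k)) * colourQuatSum L g - colourQuatSum L g * su2Quat (u (0, k))‖ ≤
      2 * ‖su2Quat (u (0, k)) - 1‖ * ‖colourQuatSum L g - ‖colourQuatSum L g‖ • (1 : ℍ)‖ := by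
    rw [mul_sub_mul_eq_comm_dev (su2Quat (u (0, k))) (colourQuatSum L g) ‖colourQuatSum L g‖]
    calc ‖(su2Quat (u (0, k)) - 1) * (colourQuatSum L g - ‖colourQuatSum L g‖ • (1 : ℍ)) -
            (colourQuatSum L g - ‖colourQuatSum L g‖ • (1 : ℍ)) * (su2Quat (u (0, k)) - 1)‖
        ≤ ‖(su2Quat (u (0, k)) - 1) * (colourQuatSum L g - ‖colourQuatSum L g‖ • (1 : ℍ))‖ +
            ‖(colourQuatSum L g - ‖colourQuatSum L g‖ • (1 : ℍ)) * (su2Quat (u (0, k)) - 1)‖ := norm_sub_le _ _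
      _ = 2 * ‖su2Quat (u (0, k)) - 1‖ * ‖colourQuatSum L g - ‖colourQuatSum L g‖ • (1 : ℍ)‖ := by rw [norm_mul, norm_mul]; ring
  -- second-order sum
  have hsec : ‖∑ x : Site 3 L, ((su2Quat (U (x, k)) - su2Quat (u (0, k))) * (su2Quat (g (x.shift k)) - 1) - (su2Quat (g x) - 1) * (su2Quat (V (x, k)) - su2Quat (u' (0, k))))‖ ≤
      A * ∑ x : Site 3 L, (‖su2Quat (U (x, k)) - su2Quat (u (0, k))‖ + ‖su2Quat (V (x, k)) - su2Quat (u' (0, k))‖) := by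
    refine (norm_sum_le _ _).trans ?_
    rw [Finset.mul_sum]
    refine Finset.sum_le_sum fun x _ => ?_
    refine (norm_sub_le _ _).trans ?_
    rw [norm_mul, norm_mul]
    have h1 := hA (x.shift k); have h2 := hA x
    have n1 := norm_nonneg (su2Quat (U (x, k)) - su2Quat (u (0, k)))
    have n2 := norm_nonneg (su2Quat (V (x, k)) - su2Quat (u' (0, k)))
    nlinarith [mul_le_mul_of_nonneg_left h1 n1, mul_le_mul_of_nonneg_right h2 n2]
  -- triangle inequalities
  have t1 := norm_sub_le (∑ x : Site 3 L, (su2Quat (U (x, k)) * su2Quat (g (x.shift k)) - su2Quat (g x) * su2Quat (V (x, k))) -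
        (su2Quat (u (0, k)) * colourQuatSum L g - colourQuatSum L g * su2Quat (u (0, k))) -
        (∑ x : Site 3 L, (su2Quat (U (x, k)) - su2Quat (u (0, k))) - ∑ x : Site 3 L, (su2Quat (V (x, k)) - su2Quat (u' (0, k)))))
    (∑ x : Site 3 L, ((su2Quat (U (x, k)) - su2Quat (u (0, k))) * (su2Quat (g (x.shift k)) - 1) - (su2Quat (g x) - 1) * (su2Quat (V (x, k)) - su2Quat (u' (0, k)))))
  have t2 := norm_sub_le (∑ x : Site 3 L, (su2Quat (U (x, k)) * su2Quat (g (x.shift k)) - su2Quat (g x) * su2Quat (V (x, k))) -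
        (su2Quat (u (0, k)) * colourQuatSum L g - colourQuatSum L g * su2Quat (u (0, k))))
    (∑ x : Site 3 L, (su2Quat (U (x, k)) - su2Quat (u (0, k))) - ∑ x : Site 3 L, (su2Quat (V (x, k)) - su2Quat (u' (0, k))))
  have t3 := norm_sub_le (∑ x : Site 3 L, (su2Quat (U (x, k)) * su2Quat (g (x.shift k)) - su2Quat (g x) * su2Quat (V (x, k))))
    (su2Quat (u (0, k)) * colourQuatSum L g - colourQuatSum L g * su2Quat (u (0, k)))
  have t4 := norm_sub_le (∑ x : Site 3 L, (su2Quat (U (x, k)) - su2Quat (u (0, k)))) (∑ x : Site 3 L, (su2Quat (V (x, k)) - su2Quat (u' (0, k))))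
  have t5 := norm_sum_le (Finset.univ : Finset (Site 3 L)) fun x => su2Quat (U (x, k)) * su2Quat (g (x.shift k)) - su2Quat (g x) * su2Quat (V (x, k))
  rw [hn]
  linarith

/-! ## §2 Tube bookkeeping: the fibre deviation of a tube link and the balance cancellation -/

omit [NeZero L] in
/-- The fibre deviation of a tube link: `q(orthoTube u v e) − q(u_k) = (chartQuat v_e − 1)·q(u_k)`. [folklore] -/
theorem su2Quat_orthoTube_sub (u : GaugeConfig 3 1 SU2) {v : Edge 3 L → Fin 3 → ℝ} (hv1 : ∀ e, ∑ a, v e a ^ 2 ≤ 1) (e : Edge 3 L) :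
    su2Quat (orthoTube L u v e) - su2Quat (u (0, e.2)) = (chartQuat (v e) - 1) * su2Quat (u (0, e.2)) := by
  rw [orthoTube_apply, Literature.MathematicalPhysics.QuantumFieldTheory.Balaban1983to89.T4HaarSU2Translate.su2Quat_mul,
    Summit.QuantumFields.YangMills.Theorems.FemtoTransferGap.su2Quat_chartSU2 (hv1 e), sub_mul, one_mul]

omit [NeZero L] in
/-- `‖chartQuat v − 1‖² ≤ 2|v|²` on the unit ball. [folklore] -/
theorem norm_chartQuat_sub_one_sq_le {w : Fin 3 → ℝ} (hw : ∑ a, w a ^ 2 ≤ 1) : ‖chartQuat w - 1‖ ^ 2 ≤ 2 * ∑ a, w a ^ 2 := by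
  have ht0 : 0 ≤ ∑ a, w a ^ 2 := Finset.sum_nonneg fun a _ => sq_nonneg _
  have h1 := one_sub_sqrt_one_sub_le ht0 hw
  have h2 : 0 ≤ 1 - √(1 - ∑ a, w a ^ 2) := by
    rw [sub_nonneg]
    have := Real.sqrt_le_sqrt (show 1 - ∑ a, w a ^ 2 ≤ 1 by linarith); rwa [Real.sqrt_one] at this
  rw [sq, ← Quaternion.normSq_eq_norm_mul_self, Quaternion.normSq_def']
  simp only [chartQuat, Quaternion.re_sub, Quaternion.imI_sub, Quaternion.imJ_sub, Quaternion.imK_sub, Quaternion.re_one, Quaternion.imI_one,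
    Quaternion.imJ_one, Quaternion.imK_one, sub_zero]
  rw [Fin.sum_univ_three] at hw ht0 h1 h2 ⊢
  nlinarith [mul_nonneg h2 h2, h1, h2]

/-- `‖μ_e‖ ≤ √2·‖v̂‖` for every tube link (`μ_e = q(U_e) − q(u_k)`). [folklore] -/
theorem norm_su2Quat_orthoTube_sub_le (u : GaugeConfig 3 1 SU2) {v : Edge 3 L → Fin 3 → ℝ} (hv1 : ∀ e, ∑ a, v e a ^ 2 ≤ 1) (e : Edge 3 L) :
    ‖su2Quat (orthoTube L u v e) - su2Quat (u (0, e.2))‖ ≤ Real.sqrt 2 * ‖linkEmbed L v‖ := by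
  rw [su2Quat_orthoTube_sub u hv1, norm_mul, norm_su2Quat, mul_one]
  have h1 := norm_chartQuat_sub_one_sq_le (hv1 e)
  have h2 : ∑ a, v e a ^ 2 ≤ ‖linkEmbed L v‖ ^ 2 := by
    rw [norm_linkEmbed_sq]
    exact Finset.single_le_sum (f := fun e : Edge 3 L => ∑ a, v e a ^ 2) (fun _ _ => Finset.sum_nonneg fun a _ => sq_nonneg _) (Finset.mem_univ e)
  have h3 : ‖chartQuat (v e) - 1‖ ^ 2 ≤ (Real.sqrt 2 * ‖linkEmbed L v‖) ^ 2 := by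
    rw [mul_pow, Real.sq_sqrt (by norm_num : (0 : ℝ) ≤ 2)]; linarith
  exact (pow_le_pow_iff_left₀ (norm_nonneg _) (by positivity) two_ne_zero).mp h3

/-- ★ **Balance**: `‖Σ_x (chartQuat v_{(x,k)} − 1)‖ ≤ Σ_x |v_{(x,k)}|²` for balanced capped `v` (the vector parts cancel; `1 − √(1−t) ≤ t`). [folklore] -/
theorem norm_sum_chartQuat_sub_one_le {v : Edge 3 L → Fin 3 → ℝ} (hv : v ∈ capBalancedSet L) (k : Fin 3) :
    ‖∑ x : Site 3 L, (chartQuat (v (x, k)) - 1)‖ ≤ ∑ x : Site 3 L, ∑ a, v (x, k) a ^ 2 := by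
  have hv1 : ∀ e : Edge 3 L, ∑ a, v e a ^ 2 ≤ 1 := sum_sq_le_one_of_cap L hv.2
  rw [Finset.sum_sub_distrib, sum_chartQuat_eq_coe L hv k, Finset.sum_const, Finset.card_univ, nsmul_eq_mul, mul_one,
    ← Quaternion.coe_natCast, ← Quaternion.coe_sub, Quaternion.norm_coe, Real.norm_eq_abs]
  have e : (∑ x : Site 3 L, √(1 - ∑ a, v (x, k) a ^ 2)) - (Fintype.card (Site 3 L) : ℝ) = ∑ x : Site 3 L, (√(1 - ∑ a, v (x, k) a ^ 2) - 1) := by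
    rw [Finset.sum_sub_distrib, Finset.sum_const, Finset.card_univ, nsmul_eq_mul, mul_one]
  rw [e]
  refine (Finset.abs_sum_le_sum_abs _ _).trans (Finset.sum_le_sum fun x _ => ?_)
  have ht0 : 0 ≤ ∑ a, v (x, k) a ^ 2 := Finset.sum_nonneg fun a _ => sq_nonneg _
  have h1 := one_sub_sqrt_one_sub_le ht0 (hv1 (x, k))
  have h2 : √(1 - ∑ a, v (x, k) a ^ 2) ≤ 1 := by
    have := Real.sqrt_le_sqrt (show 1 - ∑ a, v (x, k) a ^ 2 ≤ 1 by linarith); rwa [Real.sqrt_one] at this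
  rw [abs_of_nonpos (by linarith)]
  linarith

/-- The summed fibre deviation in direction `k`: `‖Σ_x μ_{(x,k)}‖ ≤ ‖v̂‖²`. [folklore] -/
theorem norm_sum_su2Quat_orthoTube_sub_le (u : GaugeConfig 3 1 SU2) {v : Edge 3 L → Fin 3 → ℝ} (hv : v ∈ capBalancedSet L) (k : Fin 3) :
    ‖∑ x : Site 3 L, (su2Quat (orthoTube L u v (x, k)) - su2Quat (u (0, k)))‖ ≤ ‖linkEmbed L v‖ ^ 2 := by
  have hv1 : ∀ e : Edge 3 L, ∑ a, v e a ^ 2 ≤ 1 := sum_sq_le_one_of_cap L hv.2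
  have e : ∑ x : Site 3 L, (su2Quat (orthoTube L u v (x, k)) - su2Quat (u (0, k))) = (∑ x : Site 3 L, (chartQuat (v (x, k)) - 1)) * su2Quat (u (0, k)) := by
    rw [Finset.sum_mul]
    exact Finset.sum_congr rfl fun x _ => su2Quat_orthoTube_sub u hv1 (x, k)
  rw [e, norm_mul, norm_su2Quat, mul_one]
  refine (norm_sum_chartQuat_sub_one_le hv k).trans ?_
  rw [norm_linkEmbed_sq, Fintype.sum_prod_type]
  exact Finset.sum_le_sum fun x _ => Finset.single_le_sum (f := fun k' : Fin 3 => ∑ a, v (x, k') a ^ 2) (fun _ _ => Finset.sum_nonneg fun a _ => sq_nonneg _) (Finset.mem_univ k)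

/-! ## §3 ★★★ The far-pair defect bound -/

/-- `Σ_x ‖Δ_{(x,k)}‖ ≤ Σ_e ‖Δ_e‖`. [folklore] -/
theorem sum_dir_norm_edgeDefect_le (U V : GaugeConfig 3 L SU2) (g : Site 3 L → SU2) (k : Fin 3) :
    ∑ x : Site 3 L, ‖su2Quat (U (x, k)) * su2Quat (g (x.shift k)) - su2Quat (g x) * su2Quat (V (x, k))‖ ≤
      ∑ e : Edge 3 L, ‖su2Quat (U e) * su2Quat (g (e.1.shift e.2)) - su2Quat (g e.1) * su2Quat (V e)‖ := by
  rw [Fintype.sum_prod_type]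
  exact Finset.sum_le_sum fun x _ => Finset.single_le_sum (f := fun k' : Fin 3 => ‖su2Quat (U (x, k')) * su2Quat (g (x.shift k')) - su2Quat (g x) * su2Quat (V (x, k'))‖)
    (fun _ _ => norm_nonneg _) (Finset.mem_univ k)

/-- `(Σ_e ‖Δ_e‖)² ≤ |E|·kinDefect` (Cauchy–Schwarz). [folklore] -/
theorem sq_sum_norm_edgeDefect_le (U V : GaugeConfig 3 L SU2) (g : Site 3 L → SU2) :
    (∑ e : Edge 3 L, ‖su2Quat (U e) * su2Quat (g (e.1.shift e.2)) - su2Quat (g e.1) * su2Quat (V e)‖) ^ 2 ≤ (Fintype.card (Edge 3 L) : ℝ) * kinDefect L U V g := by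
  have h := Finset.sum_mul_sq_le_sq_mul_sq (Finset.univ : Finset (Edge 3 L)) (fun _ => (1 : ℝ))
    (fun e => ‖su2Quat (U e) * su2Quat (g (e.1.shift e.2)) - su2Quat (g e.1) * su2Quat (V e)‖)
  simp only [one_mul, one_pow, Finset.sum_const, Finset.card_univ, nsmul_eq_mul, mul_one] at h
  unfold kinDefect
  exact h

/-- ★★★ **FAR-PAIR DEFECT BOUND** on the tube: all gauge jumps `≤ R`, `3LR < 1`, `colourMean g ∈ fpBall ε`, balanced capped fibres ⇒
`N(1 − 3LR)·‖q(u_k) − q(u'_k)‖ ≤ Σ_e ‖Δ_e‖ + 2εN‖q(u_k) − 1‖ + ‖v̂‖² + ‖v̂'‖² + √2·N(9LR + ε)(‖v̂‖ + ‖v̂'‖)`. [cite: Luscher1983, §3] -/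
theorem far_pair_defect_bound (u u' : GaugeConfig 3 1 SU2) {v v' : Edge 3 L → Fin 3 → ℝ} (hv : v ∈ capBalancedSet L) (hv' : v' ∈ capBalancedSet L)
    {g : Site 3 L → SU2} {R ε : ℝ} (hR : ∀ e : Edge 3 L, ‖su2Quat (g (e.1.shift e.2)) - su2Quat (g e.1)‖ ≤ R) (hR1 : 3 * L * R < 1) (hε : 0 ≤ ε)
    (hW : colourMean L g ∈ fpBall ε) (k : Fin 3) :
    (Fintype.card (Site 3 L) : ℝ) * (1 - 3 * L * R) * ‖su2Quat (u (0, k)) - su2Quat (u' (0, k))‖ ≤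
      ∑ e : Edge 3 L, ‖su2Quat (orthoTube L u v e) * su2Quat (g (e.1.shift e.2)) - su2Quat (g e.1) * su2Quat (orthoTube L u' v' e)‖ +
        2 * ε * Fintype.card (Site 3 L) * ‖su2Quat (u (0, k)) - 1‖ + ‖linkEmbed L v‖ ^ 2 + ‖linkEmbed L v'‖ ^ 2 +
        Real.sqrt 2 * Fintype.card (Site 3 L) * (9 * L * R + ε) * (‖linkEmbed L v‖ + ‖linkEmbed L v'‖) := by
  have hv1 : ∀ e : Edge 3 L, ∑ a, v e a ^ 2 ≤ 1 := sum_sq_le_one_of_cap L hv.2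
  have hv'1 : ∀ e : Edge 3 L, ∑ a, v' e a ^ 2 ≤ 1 := sum_sq_le_one_of_cap L hv'.2
  have hN : (0 : ℝ) < Fintype.card (Site 3 L) := by exact_mod_cast Fintype.card_pos
  have hR0 : 0 ≤ R := (norm_nonneg _).trans (hR default)
  have hpath := norm_su2Quat_sub_base_le (L := L) hR
  have hA := norm_su2Quat_sub_one_le_of_jumps (L := L) hR hR1 hW
  have hS0 := colourQuatSum_ne_zero_of_near (L := L) hR1 hpath
  have hSN := abs_norm_colourQuatSum_sub_le (L := L) hpath
  have hpin := norm_colourQuatSum_sub_smul_one_le (L := L) hS0 hW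
  have hSle : ‖colourQuatSum L g‖ ≤ Fintype.card (Site 3 L) := by
    unfold colourQuatSum
    refine (norm_sum_le _ _).trans ?_
    simp only [norm_su2Quat, Finset.sum_const, Finset.card_univ, nsmul_eq_mul, mul_one, le_refl]
  have hSge : (Fintype.card (Site 3 L) : ℝ) * (1 - 3 * L * R) ≤ ‖colourQuatSum L g‖ := by
    have := (abs_le.mp hSN).1; nlinarith
  have hmain := norm_colourSum_mul_slow_sub_le (orthoTube L u v) (orthoTube L u' v') u u' g k hA
  have hμ := norm_sum_su2Quat_orthoTube_sub_le u hv k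
  have hμ' := norm_sum_su2Quat_orthoTube_sub_le u' hv' k
  have hμb : ∑ x : Site 3 L, (‖su2Quat (orthoTube L u v (x, k)) - su2Quat (u (0, k))‖ + ‖su2Quat (orthoTube L u' v' (x, k)) - su2Quat (u' (0, k))‖) ≤
      Fintype.card (Site 3 L) * (Real.sqrt 2 * (‖linkEmbed L v‖ + ‖linkEmbed L v'‖)) := by
    refine (Finset.sum_le_sum fun x _ => add_le_add (norm_su2Quat_orthoTube_sub_le u hv1 (x, k)) (norm_su2Quat_orthoTube_sub_le u' hv'1 (x, k))).trans ?_
    rw [Finset.sum_const, Finset.card_univ, nsmul_eq_mul]; ring_nf; rfl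
  have hdir := sum_dir_norm_edgeDefect_le (orthoTube L u v) (orthoTube L u' v') g k
  have hpin' : ‖colourQuatSum L g - ‖colourQuatSum L g‖ • (1 : ℍ)‖ ≤ ε * Fintype.card (Site 3 L) :=
    hpin.trans (mul_le_mul_of_nonneg_left hSle hε)
  have k1 : 2 * ‖su2Quat (u (0, k)) - 1‖ * ‖colourQuatSum L g - ‖colourQuatSum L g‖ • (1 : ℍ)‖ ≤ 2 * ‖su2Quat (u (0, k)) - 1‖ * (ε * Fintype.card (Site 3 L)) :=
    mul_le_mul_of_nonneg_left hpin' (by positivity)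
  have k2 : (9 * L * R + ε) * ∑ x : Site 3 L, (‖su2Quat (orthoTube L u v (x, k)) - su2Quat (u (0, k))‖ + ‖su2Quat (orthoTube L u' v' (x, k)) - su2Quat (u' (0, k))‖) ≤
      (9 * L * R + ε) * (Fintype.card (Site 3 L) * (Real.sqrt 2 * (‖linkEmbed L v‖ + ‖linkEmbed L v'‖))) :=
    mul_le_mul_of_nonneg_left hμb (by positivity)
  have k3 : (Fintype.card (Site 3 L) : ℝ) * (1 - 3 * L * R) * ‖su2Quat (u (0, k)) - su2Quat (u' (0, k))‖ ≤
      ‖colourQuatSum L g‖ * ‖su2Quat (u (0, k)) - su2Quat (u' (0, k))‖ := mul_le_mul_of_nonneg_right hSge (norm_nonneg _)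
  linarith [hmain, hμ, hμ', hdir, k1, k2, k3]

end Summit.QuantumFields.YangMills.Theorems.FemtoTransferGap.TwoLattice.ConstTube

end
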